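import Summits.BirchSwinnertonDyer.BirchSwinnertonDyer.Theorems.ManinLocalTwoThreeManinConstantOfStevensInclusion
import Summits.BirchSwinnertonDyer.BirchSwinnertonDyer.Theorems.EdixhovenFibreFiveSevenStarredOptimalManinUnitFiveSevenCdtThm1
import HarnessLib

set_option autoImplicit false
-- the sub-problem namespace `Summit.BirchSwinnertonDyer.BirchSwinnertonDyer` duplicates a component by design (D-0017)
set_option linter.dupNamespace false

/-!
# Mazur 1978 Cor. 4.1 (the Manin constant at odd primes) as a tree theorem; support item
# `MazurManinConstantOddPrimes` (stmt-BirchSwinnertonDyer-19383) closed by name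

The printed fact `Literature.NumberTheory.EllipticCurves.ModularForms.mazur_not_dvd_maninConstant_of_odd` (Mazur 1978,
Cor. 4.1, lattice rendering: for every globally minimal `W'/ℚ`, every lattice-optimal `X₀(N')`-datum `D'`
(`Λ_{W'} = c · Λ₀(f)`) and every odd prime `p` with `p² ∤ N'`, `p ∤ c`) was a statement-only (cite-only) dependency of
fifteen BSD routes and the signature of the shared support item stmt-BirchSwinnertonDyer-19383.  It is now PROVED:

* Stevens' inclusion `Λ₁(f) ⊆ Λ_W` for every `X₀(N)`-datum of a globally minimal curve follows from the Unbounded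
  Denominators theorem [CalegariDimitrovTang2025, Thm. 1.0.1] by the integer `c`-division chain
  (`ManinLocalTwoThree.CDivisionInt.periodLatticeGamma1_le_neron_of_CDTInt`, cell bsd-f2-manin);
* the conjugation obstruction then forbids `p ∣ c₀` for every `p ≥ 3` at EVERY level
  (`ManinLocalTwoThree.KummerValues.not_dvd_maninConstant_of_CDT`, `mazur_of_CDT`);
* the Unbounded Denominators theorem is the tree theorem `calegariDimitrovTang2025_unboundedDenominators_holds` (line
  `cdt_thm1` of crux K★ stmt-BirchSwinnertonDyer-22226: CDT Cor. 4.5.3 in invariant form for all levels,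
  `HcorTwoPow.stub_hcor_invariant_all`, composed with `of_cor453_invariant`).

This file records the UNCONDITIONAL forms — Stevens' inclusion and `p ∤ c₀` for `p ≥ 3` (so `|c₀| ≤ 2`,
`KummerValues.natAbs_maninConstant_le_two_of_CDT`) — discharges the named fact (`mazur_not_dvd_maninConstant_of_odd_holds`;
its level hypothesis `p² ∤ N'` is not even used) and closes the support item BY NAME through route ManinLocalTwoThree's
declaration.  (The file necessarily imports the route-cone modules that carry the integer chain and the CDT discharge.)

HONEST STATUS.  Manin's conjecture (`|c₀| = 1`) is NOT proved here: the prime `2` is open at levels `4 ∣ N` without an odd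
square factor (crux C2 `ManinOddAtFour`, stmt-BirchSwinnertonDyer-22967).  BSD is not proved by this.  The meaning of
these kernel terms rests on the tree's vendored definitions (`ModularParametrizationData`, `periodLattice`,
`periodLatticeGamma1`, `maninConstant`, the CDT statement over Mathlib's `ModularForm`), whose statement audit is pending.
[cite: Mazur1978, Cor. 4.1] [cite: CalegariDimitrovTang2025, Thm. 1.0.1] [cite: Stevens1989, §2] [cite: Manin1972, §1.6]
-/

noncomputable section

open WeierstrassCurve
open Literature.NumberTheory.EllipticCurves Literature.NumberTheory.EllipticCurves.ModularForms
open Literature.NumberTheory.Automorphic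

namespace Summit.BirchSwinnertonDyer.BirchSwinnertonDyer.Theorems

/-! ## §1 Unconditional forms of the Stevens-inclusion consequences -/

/-- **Stevens' inclusion `Λ₁(f) ⊆ Λ_W`, unconditionally**: for every globally minimal `W/ℚ` and every `X₀(N)`-datum `D`
of `W`, every `Γ₁(N)`-period of `D.f` lies in the Néron lattice of `W` — the integer `c`-division chain
(`CDivisionInt.periodLatticeGamma1_le_neron_of_CDTInt`) applied to the tree theorem
`calegariDimitrovTang2025_unboundedDenominators_holds`. [cite: CalegariDimitrovTang2025, Thm. 1.0.1] [cite: Stevens1989, §2] -/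
theorem periodLatticeGamma1_le_neron {W : WeierstrassCurve ℚ} [W.IsElliptic] [W.IsGloballyMinimal] {N : ℕ} [NeZero N]
    (D : ModularParametrizationData W N) : ∀ z ∈ periodLatticeGamma1 D.f, z ∈ D.L.lattice :=
  ManinLocalTwoThree.CDivisionInt.periodLatticeGamma1_le_neron_of_CDTInt
    calegariDimitrovTang2025_unboundedDenominators_holds D

/-- **`p ∤ c₀` for every `p ≥ 3` at EVERY level, unconditionally**: for a globally minimal `W₀/ℚ` and a lattice-optimal
`X₀(N)`-datum `D₀` (`Λ_{W₀} ⊆ c · Λ₀(f)`), no integer `p ≥ 3` divides the Manin constant — Stevens' inclusion (§1) and the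
conjugation obstruction (`KummerValues.not_dvd_maninConstant_of_gamma1Periods_le`).  Contains Mazur 1978 Cor. 4.1 (odd `p`,
`p² ∤ N`), Abbes–Ullmo 1996 Thm. A at odd `p ∤ N`, and Edixhoven's additive-prime results at `p > 7`.
[cite: CalegariDimitrovTang2025, Thm. 1.0.1] [cite: Stevens1989, §2] [cite: Manin1972, §1.6] -/
theorem not_dvd_maninConstant_of_three_le (W₀ : WeierstrassCurve ℚ) [W₀.IsElliptic] [W₀.IsGloballyMinimal] {N : ℕ}
    [NeZero N] (D₀ : ModularParametrizationData W₀ N)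
    (hopt : ∀ z ∈ D₀.L.lattice, ∃ w ∈ periodLattice D₀.f, z = D₀.c * w) {p : ℕ} (hp : 3 ≤ p) :
    ¬ (p : ℤ) ∣ D₀.maninConstant :=
  ManinLocalTwoThree.KummerValues.not_dvd_maninConstant_of_gamma1Periods_le D₀ hopt (periodLatticeGamma1_le_neron D₀) hp

/-! ## §2 The named fact and the support item -/

/-- **Mazur 1978, Cor. 4.1 holds** (the Literature named fact `mazur_not_dvd_maninConstant_of_odd`, lattice rendering):
for every globally minimal `W'/ℚ`, every lattice-optimal `X₀(N')`-datum and every odd prime `p` with `p² ∤ N'`, `p ∤ c`.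
Discharged from §1 (the level hypothesis is idle). [cite: Mazur1978, Cor. 4.1] [cite: CalegariDimitrovTang2025, Thm. 1.0.1] -/
theorem mazur_not_dvd_maninConstant_of_odd_holds : mazur_not_dvd_maninConstant_of_odd := by
  intro W' _ _ N' _ D' hopt p hp hp2 _
  exact not_dvd_maninConstant_of_three_le W' D' hopt (by have := hp.two_le; omega)

/-- **Support item `MazurManinConstantOddPrimes` (stmt-BirchSwinnertonDyer-19383), proved by name** through route
ManinLocalTwoThree's declaration (the item is shared verbatim by fifteen BSD routes).  BSD is NOT proved by this; Manin's
conjecture is NOT proved by this. [cite: Mazur1978, Cor. 4.1] [cite: CalegariDimitrovTang2025, Thm. 1.0.1] -/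
theorem ManinLocalTwoThree.MazurManinConstantOddPrimes_proof :
    Summit.BirchSwinnertonDyer.BirchSwinnertonDyer.Theses.ManinLocalTwoThree.MazurManinConstantOddPrimes :=
  mazur_not_dvd_maninConstant_of_odd_holds

end Summit.BirchSwinnertonDyer.BirchSwinnertonDyer.Theorems

end
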